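import Mathlib.Analysis.SpecialFunctions.ImproperIntegrals
import Literature.NumberTheory.LFunctions.WeilExplicitContinuous
import Literature.NumberTheory.LFunctions.WeilExplicitArchTermProofs
import HarnessLib

/-!
# The explicit formula in Bombieri's form for Lipschitz compactly supported test functions
# (Suzuki, CJM 2025, eq. (3.3) — the form used in the proof of Prop. 3.1)

LINE 1 — LABEL: RH-FREE analysis (Weil's explicit formula for a wider class of test functions; no
positivity statement, no input on the location of zeros).  Cell `rh-crit/dbl`, support for the
discharge of `Suzuki2025_prop31` (CJM Prop 3.1, `𝔓_t = P_t`).  bears_on: B-C/B-P (COLUMN 6 DBR) as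
infrastructure only.  WHAT THIS IS NOT: nothing here bears on the truth of RH.

M. Suzuki, *On the Hilbert space derived from the Weil distribution*, Canad. J. Math. (2025) =
arXiv:2301.00421v3, proof of Prop. 3.1 (TeX l.794–826) uses «the Weil explicit formula

  `lim_{X→∞} Σ_{|γ|≤X} m_γ ∫ φ(x) e^{−iγx} dx = ∫ φ(x)(e^{x/2} + e^{−x/2}) dx − Σ_n Λ(n)n^{−1/2} φ(log n)`
  `− Σ_n Λ(n) n^{−1/2} φ(−log n) − (log 4π + γ₀) φ(0) − ∫₀^∞ {φ(x) + φ(−x) − 2e^{−x/2}φ(0)} e^{x/2}dx/(eˣ − e^{−x})`   (3.3)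

which is obtained from the explicit formula in [Bombieri 2000, p. 186]», applied to a test function
`φ_{z,t}` that is continuous and piecewise smooth but NOT smooth.  In the tree's vocabulary
(`WeilExplicit.lean`): with `γ = i(ρ − ½)` one has `∫ φ e^{−iγx} = weilMellin φ ρ`, the first term is
`weilPolarTerm φ`, the two prime sums are `weilPrimeTerm φ`, and the last two terms are EXACTLY
`weilArchTermBombieri φ` (`eˣ − e^{−x} = 2 sinh x`).  The tree proves the formula with the DIGAMMA
archimedean term `weilArchTerm` for continuous compactly supported `g` with absolutely convergent zero
side and integrable archimedean integrand (`explicit_formula_continuous`), and the identity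
`weilArchTermBombieri g = weilArchTerm g` for SMOOTH compactly supported `g`
(`weilArchTermBombieri_eq_weilArchTerm_holds`, Bombieri 2000 (2.8)).  This file extends the latter
identity, hence (3.3), to **continuous, compactly supported, Lipschitz** `g` — the class containing
the compactly supported combinations `c_t φ_{z,t} − c_{t'} φ_{z,t'}` of Suzuki's test functions:

* `WeilBombieriLipschitz.tendsto_weilArchTermBombieri_moll` — along the mollification `g ⋆ φ_k` of
  `WeilExplicitContinuous.lean`, Bombieri's archimedean term converges (dominated convergence on
  `(0,∞)`: `‖g ⋆ φ_k‖_∞ ≤ ‖g‖_∞`, `Lip(g ⋆ φ_k) ≤ Lip g`, majorant `C e^{−x}`);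
* `weilArchTermBombieri_eq_weilArchTerm_of_lipschitz` — Bombieri's form = digamma form for such `g`;
* `explicit_formula_continuous_bombieri` — **(3.3)**: `HasWeilZeroSide g (weilPolarTerm g −
  weilPrimeTerm g + weilArchTermBombieri g)`, and `tsum_zeroSide_eq_bombieri` (the absolutely
  convergent zero side equals the right-hand side of (3.3)).

Everything here is proved; there are no named facts and no new definitions.

## References

* [Suzuki2025WeilHilbertSpace] M. Suzuki, Canad. J. Math. (2025), doi:10.4153/S0008414X25101739 =
  arXiv:2301.00421v3, eq. (3.3) (TeX l.804–820).
* [Bombieri2000Weil] E. Bombieri, Rend. Mat. Acc. Lincei (9) 11 (2000), Thm. 2 and (2.8), p. 186.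
-/

noncomputable section

open Complex Filter Set MeasureTheory Topology
open scoped Real NNReal

namespace Literature.NumberTheory.LFunctions

open WeilContinuous

namespace WeilBombieriLipschitz

variable {g : ℝ → ℂ}

/-- `(g ⋆ h)(x) = ∫ g(x − v) h(v) dv` (the substitution `u = x − v` in `weilConv_apply`). [folklore] -/
private theorem weilConv_apply' (g h : ℝ → ℂ) (x : ℝ) : weilConv g h x = ∫ v : ℝ, g (x - v) * h v := by
  rw [weilConv_apply, ← integral_sub_left_eq_self (fun u ↦ g u * h (x - u)) volume x]
  simp [sub_sub_cancel]

/-- `‖g ⋆ φ_k‖_∞ ≤ ‖g‖_∞` (`φ_k ≥ 0`, `∫ φ_k = 1`). [folklore] -/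
private theorem norm_weilConv_moll_le {M : ℝ} (hM : ∀ x, ‖g x‖ ≤ M) (k : ℕ) (x : ℝ) :
    ‖weilConv g (moll k) x‖ ≤ M := by
  rw [weilConv_apply']
  calc ‖∫ v : ℝ, g (x - v) * moll k v‖ ≤ ∫ v : ℝ, ‖g (x - v) * moll k v‖ :=
        norm_integral_le_integral_norm _
    _ ≤ ∫ v : ℝ, M * ‖moll k v‖ := by
        refine integral_mono_of_nonneg (Eventually.of_forall fun _ ↦ norm_nonneg _)
          ((integrable_norm_moll k).const_mul M) (Eventually.of_forall fun v ↦ ?_)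
        dsimp only
        rw [norm_mul]
        exact mul_le_mul_of_nonneg_right (hM _) (norm_nonneg _)
    _ = M := by rw [MeasureTheory.integral_const_mul, integral_norm_moll, mul_one]

/-- `Lip(g ⋆ φ_k) ≤ Lip(g)`. [folklore] -/
private theorem norm_weilConv_moll_sub_le {L : ℝ≥0} (hL : LipschitzWith L g) (hgc : Continuous g) (k : ℕ)
    (x y : ℝ) : ‖weilConv g (moll k) x - weilConv g (moll k) y‖ ≤ L * |x - y| := by
  rw [weilConv_apply', weilConv_apply']
  have hint : ∀ z : ℝ, Integrable fun v : ℝ ↦ g (z - v) * moll k v := fun z ↦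
    ((hgc.comp (continuous_const.sub continuous_id)).mul (continuous_moll k)).integrable_of_hasCompactSupport
      (hasCompactSupport_moll k).mul_left
  rw [← integral_sub (hint x) (hint y)]
  calc ‖∫ v, (g (x - v) * moll k v - g (y - v) * moll k v)‖
      ≤ ∫ v, ‖g (x - v) * moll k v - g (y - v) * moll k v‖ := norm_integral_le_integral_norm _
    _ ≤ ∫ v, (L * |x - y|) * ‖moll k v‖ := by
        refine integral_mono_of_nonneg (Eventually.of_forall fun _ ↦ norm_nonneg _)
          ((integrable_norm_moll k).const_mul _) (Eventually.of_forall fun v ↦ ?_)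
        dsimp only
        rw [← sub_mul, norm_mul]
        refine mul_le_mul_of_nonneg_right ?_ (norm_nonneg _)
        have h := hL.norm_sub_le (x - v) (y - v)
        rwa [show x - v - (y - v) = x - y by ring, Real.norm_eq_abs] at h
    _ = L * |x - y| := by rw [MeasureTheory.integral_const_mul, integral_norm_moll, mul_one]

/-- A continuous compactly supported function is bounded. [folklore] -/
private theorem exists_norm_le (hgc : Continuous g) (hgs : HasCompactSupport g) : ∃ M, 0 ≤ M ∧ ∀ x, ‖g x‖ ≤ M := by
  obtain ⟨C, hC⟩ := (hgs.isCompact_range hgc).isBounded.exists_norm_le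
  exact ⟨max C 0, le_max_right _ _, fun x ↦ (hC _ (mem_range_self x)).trans (le_max_left _ _)⟩

/-- `e^{y} − 1 ≤ y e^{y}` (from `1 − y ≤ e^{−y}`). [folklore] -/
private theorem exp_sub_one_le_mul_exp (y : ℝ) : Real.exp y - 1 ≤ y * Real.exp y := by
  have h := Real.add_one_le_exp (-y)
  have hpos := Real.exp_pos y
  have : Real.exp (-y) * Real.exp y = 1 := by rw [← Real.exp_add]; simp
  nlinarith

/-- `sinh x ≥ eˣ/4` for `x ≥ 1` (indeed for `x ≥ ½ log 2`). [folklore] -/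
private theorem exp_div_four_le_sinh {x : ℝ} (hx : 1 ≤ x) : Real.exp x / 4 ≤ Real.sinh x := by
  rw [Real.sinh_eq]
  have h1 : Real.exp (-x) ≤ Real.exp (-1) := Real.exp_le_exp.2 (by linarith)
  have h2 : Real.exp (-1) ≤ 1 / 2 := by
    have := Real.exp_one_gt_d9
    rw [Real.exp_neg, inv_le_comm₀ (Real.exp_pos 1) (by norm_num)]
    linarith
  have h3 : (2 : ℝ) ≤ Real.exp x := by
    have := Real.add_one_le_exp x; linarith
  linarith

/-- The numerator of Bombieri's integrand, `e^{x/2}(f(x) + f(−x)) − 2f(0)`, is `≤ x (M e^{x/2} + 2L)`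
for `0 ≤ x` when `‖f‖ ≤ M` and `f` is `L`-Lipschitz. [folklore] -/
private theorem norm_numerator_le {f : ℝ → ℂ} {M L : ℝ} (hM : ∀ x, ‖f x‖ ≤ M)
    (hL : ∀ x y, ‖f x - f y‖ ≤ L * |x - y|) {x : ℝ} (hx : 0 ≤ x) :
    ‖((Real.exp (x / 2) : ℂ) * (f x + f (-x)) - 2 * f 0)‖ ≤ x * (M * Real.exp (x / 2) + 2 * L) := by
  have hM0 : 0 ≤ M := (norm_nonneg _).trans (hM 0)
  have he : Real.exp (x / 2) - 1 ≤ x / 2 * Real.exp (x / 2) := exp_sub_one_le_mul_exp (x / 2)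
  have he0 : 0 ≤ Real.exp (x / 2) - 1 := by
    have := Real.one_le_exp (by linarith : 0 ≤ x / 2); linarith
  have hsplit : ((Real.exp (x / 2) : ℂ) * (f x + f (-x)) - 2 * f 0) =
      ((Real.exp (x / 2) - 1 : ℝ) : ℂ) * (f x + f (-x)) + ((f x - f 0) + (f (-x) - f 0)) := by
    push_cast; ring
  rw [hsplit]
  have h1 : ‖((Real.exp (x / 2) - 1 : ℝ) : ℂ) * (f x + f (-x))‖ ≤ (Real.exp (x / 2) - 1) * (2 * M) := by
    rw [norm_mul, Complex.norm_real, Real.norm_of_nonneg he0]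
    exact mul_le_mul_of_nonneg_left ((norm_add_le _ _).trans (by linarith [hM x, hM (-x)])) he0
  have h2 : ‖f x - f 0‖ ≤ L * x := by simpa [abs_of_nonneg hx] using hL x 0
  have h3 : ‖f (-x) - f 0‖ ≤ L * x := by simpa [abs_of_nonneg hx] using hL (-x) 0
  calc ‖((Real.exp (x / 2) - 1 : ℝ) : ℂ) * (f x + f (-x)) + ((f x - f 0) + (f (-x) - f 0))‖
      ≤ (Real.exp (x / 2) - 1) * (2 * M) + (L * x + L * x) :=
        (norm_add_le _ _).trans (add_le_add h1 ((norm_add_le _ _).trans (add_le_add h2 h3)))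
    _ ≤ x / 2 * Real.exp (x / 2) * (2 * M) + (L * x + L * x) := by gcongr
    _ = x * (M * Real.exp (x / 2) + 2 * L) := by ring

/-- Bombieri's integrand for `f`. [cite: Bombieri2000Weil, Thm. 2 (the last integral, x = e^t)] -/
private theorem bombieriIntegrand_def (f : ℝ → ℂ) (t : ℝ) :
    ((Real.exp (t / 2) : ℂ) * (f t + f (-t)) - 2 * f 0) / (2 * Real.sinh t : ℂ) =
      ((Real.exp (t / 2) : ℂ) * (f t + f (-t)) - 2 * f 0) / ((2 * Real.sinh t : ℝ) : ℂ) := by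
  push_cast; rfl

/-- **Convergence of Bombieri's archimedean term along the mollification** of a continuous, compactly
supported, Lipschitz `g` (dominated convergence on `(0, ∞)` with majorant `C e^{−x}`).
[cite: Bombieri2000Weil, Thm. 2 and (2.8); Suzuki2025WeilHilbertSpace, eq. (3.3) (TeX l.804–820)] -/
theorem tendsto_weilArchTermBombieri_moll (hgc : Continuous g) (hgs : HasCompactSupport g)
    {L : ℝ≥0} (hL : LipschitzWith L g) :
    Tendsto (fun k ↦ weilArchTermBombieri (weilConv g (moll k))) atTop
      (𝓝 (weilArchTermBombieri g)) := by
  obtain ⟨R, hR0, hR⟩ := exists_support_radius hgs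
  obtain ⟨M, hM0, hM⟩ := exists_norm_le hgc hgs
  have hpt : ∀ x, Tendsto (fun k ↦ weilConv g (moll k) x) atTop (𝓝 (g x)) :=
    fun x ↦ tendsto_weilConv_moll hgc x
  have hMk : ∀ k x, ‖weilConv g (moll k) x‖ ≤ M := fun k x ↦ norm_weilConv_moll_le hM k x
  have hLk : ∀ k x y, ‖weilConv g (moll k) x - weilConv g (moll k) y‖ ≤ L * |x - y| :=
    fun k x y ↦ norm_weilConv_moll_sub_le hL hgc k x y
  have hzero : ∀ k x, R + 1 < |x| → weilConv g (moll k) x = 0 := fun k x hx ↦ weilConv_moll_eq_zero hR hx k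
  -- the majorant
  set K : ℝ := M * Real.exp ((R + 1) / 2) + 2 * L with hK
  have hK0 : 0 ≤ K := by positivity
  set C₀ : ℝ := max (K / 2) (4 * M) * Real.exp (R + 1) with hC₀
  have hC₀0 : 0 ≤ C₀ := by positivity
  unfold weilArchTermBombieri
  refine ((tendsto_const_nhds.mul (hpt 0)).add ?_).neg
  refine tendsto_integral_of_dominated_convergence (fun x ↦ C₀ * Real.exp (-x)) ?_ ?_ ?_ ?_
  · -- measurability
    intro k
    have hc : Continuous (weilConv g (moll k)) := (isWeilTest_weilConv_moll hgc hgs k).1.continuous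
    have hnum : Continuous fun t : ℝ ↦ ((Real.exp (t / 2) : ℂ) * (weilConv g (moll k) t +
        weilConv g (moll k) (-t)) - 2 * weilConv g (moll k) 0) := by fun_prop
    have hden : Continuous fun t : ℝ ↦ (2 * Real.sinh t : ℂ) := by fun_prop
    exact (hnum.measurable.div hden.measurable).aestronglyMeasurable
  · -- the majorant is integrable on `(0, ∞)`
    exact ((integrableOn_exp_neg_Ioi 0).const_mul C₀)
  · -- domination
    intro k
    rw [ae_restrict_iff' measurableSet_Ioi]
    refine Eventually.of_forall fun x (hx : 0 < x) ↦ ?_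
    have hsinh : 0 < Real.sinh x := Real.sinh_pos_iff.2 hx
    have hden : ‖(2 * Real.sinh x : ℂ)‖ = 2 * Real.sinh x := by
      rw [show (2 * Real.sinh x : ℂ) = ((2 * Real.sinh x : ℝ) : ℂ) by push_cast; rfl, Complex.norm_real,
        Real.norm_of_nonneg (by positivity)]
    rw [norm_div, hden]
    rcases le_or_gt x (R + 1) with hxR | hxR
    · -- `0 < x ≤ R + 1`: numerator `≤ xK`, `sinh x ≥ x`
      have hnum := norm_numerator_le (hMk k) (hLk k) hx.le
      have hxK : x * (M * Real.exp (x / 2) + 2 * L) ≤ x * K := by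
        refine mul_le_mul_of_nonneg_left ?_ hx.le
        rw [hK]; gcongr
      have hsx : x ≤ Real.sinh x := Real.self_le_sinh_iff.2 hx.le
      calc ‖(Real.exp (x / 2) : ℂ) * (weilConv g (moll k) x + weilConv g (moll k) (-x)) -
              2 * weilConv g (moll k) 0‖ / (2 * Real.sinh x)
          ≤ x * K / (2 * Real.sinh x) := by gcongr; exact hnum.trans hxK
        _ ≤ K / 2 := by
            rw [div_le_iff₀ (by positivity)]
            nlinarith
        _ ≤ max (K / 2) (4 * M) * Real.exp (R + 1) * Real.exp (-x) := by
            have h1 : K / 2 ≤ max (K / 2) (4 * M) := le_max_left _ _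
            have h2 : 1 ≤ Real.exp (R + 1) * Real.exp (-x) := by
              rw [← Real.exp_add]; exact Real.one_le_exp (by linarith)
            have h3 : 0 ≤ max (K / 2) (4 * M) := le_trans (by positivity) h1
            calc K / 2 ≤ max (K / 2) (4 * M) := h1
              _ ≤ max (K / 2) (4 * M) * (Real.exp (R + 1) * Real.exp (-x)) := le_mul_of_one_le_right h3 h2
              _ = _ := by ring
        _ = C₀ * Real.exp (-x) := by simp only [hC₀]
    · -- `x > R + 1 ≥ 1`: `g_k(±x) = 0`, numerator `= −2 g_k(0)`, `sinh x ≥ eˣ/4`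
      have hx1 : 1 ≤ x := by linarith
      have hz1 : weilConv g (moll k) x = 0 := hzero k x (by rwa [abs_of_pos hx])
      have hz2 : weilConv g (moll k) (-x) = 0 := hzero k (-x) (by rwa [abs_neg, abs_of_pos hx])
      rw [hz1, hz2, add_zero, mul_zero, zero_sub, norm_neg, norm_mul, Complex.norm_two]
      have hs := exp_div_four_le_sinh hx1
      have h0 := hMk k 0
      calc 2 * ‖weilConv g (moll k) 0‖ / (2 * Real.sinh x) ≤ 2 * M / (2 * (Real.exp x / 4)) := by
            gcongr
        _ = 4 * M * Real.exp (-x) := by rw [Real.exp_neg]; field_simp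
        _ ≤ max (K / 2) (4 * M) * Real.exp (R + 1) * Real.exp (-x) := by
            have h1 : 4 * M ≤ max (K / 2) (4 * M) := le_max_right _ _
            have h2 : 1 ≤ Real.exp (R + 1) := Real.one_le_exp (by linarith)
            have h3 : 0 ≤ max (K / 2) (4 * M) := le_trans (by positivity) h1
            have h4 : 0 < Real.exp (-x) := Real.exp_pos _
            have h5 : 4 * M ≤ max (K / 2) (4 * M) * Real.exp (R + 1) :=
              h1.trans (le_mul_of_one_le_right h3 h2)
            exact mul_le_mul_of_nonneg_right h5 h4.le
        _ = C₀ * Real.exp (-x) := by simp only [hC₀]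
  · -- pointwise convergence
    rw [ae_restrict_iff' measurableSet_Ioi]
    refine Eventually.of_forall fun x _ ↦ ?_
    exact ((tendsto_const_nhds.mul ((hpt x).add (hpt (-x)))).sub
      (tendsto_const_nhds.mul (hpt 0))).div_const _

end WeilBombieriLipschitz

open WeilBombieriLipschitz

/-- **Bombieri's archimedean term equals the digamma form for continuous, compactly supported,
Lipschitz test functions** (extension of the tree's `weilArchTermBombieri_eq_weilArchTerm_holds`,
[Bombieri 2000] (2.8), from `C_c^∞` by mollification: both sides converge along `g ⋆ φ_k`).  The
hypothesis `hA` (integrability of `ĝ(½+it) Re ψ(¼+it/2)`) is the one of `explicit_formula_continuous`.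
[cite: Bombieri2000Weil, eq. (2.8); Suzuki2025WeilHilbertSpace, eq. (3.3) (TeX l.804–820)] -/
theorem weilArchTermBombieri_eq_weilArchTerm_of_lipschitz {g : ℝ → ℂ} (hgc : Continuous g)
    (hgs : HasCompactSupport g) {L : ℝ≥0} (hL : LipschitzWith L g)
    (hA : Integrable fun t : ℝ ↦ weilMellin g (1 / 2 + t * I) * ((Complex.digamma (1 / 4 + t / 2 * I)).re : ℂ)) :
    weilArchTermBombieri g = weilArchTerm g := by
  have h1 := tendsto_weilArchTermBombieri_moll hgc hgs hL
  have h2 : Tendsto (fun k ↦ weilArchTerm (weilConv g (moll k))) atTop (𝓝 (weilArchTerm g)) := by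
    unfold weilArchTerm
    exact ((tendsto_weilArchIntegral_moll hgc hgs hA).const_mul _).sub
      ((tendsto_weilConv_moll hgc 0).mul_const _)
  have heq : (fun k ↦ weilArchTermBombieri (weilConv g (moll k))) =
      fun k ↦ weilArchTerm (weilConv g (moll k)) :=
    funext fun k ↦ weilArchTermBombieri_eq_weilArchTerm_holds (isWeilTest_weilConv_moll hgc hgs k)
  rw [heq] at h1
  exact tendsto_nhds_unique h1 h2

/-- **Suzuki's (3.3) = the explicit formula in Bombieri's form**, for continuous, compactly supported,
Lipschitz `g` whose zero side converges absolutely and whose archimedean integrand is integrable: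
`lim_T Σ_{|Im ρ|≤T} m(ρ) ĝ(ρ) = ĝ(0) + ĝ(1) − Σ Λ(n)n^{−1/2}(g(log n) + g(−log n)) − (log 4π + γ₀)g(0)
− ∫₀^∞ (e^{x/2}(g(x)+g(−x)) − 2g(0)) dx/(2 sinh x)` (with `ĝ(ρ) = ∫ g e^{(ρ−½)x} = ∫ g e^{−iγx}`,
`γ = i(ρ−½)`; the printed truncation `|γ| ≤ X` and the tree's `|Im ρ| ≤ T` agree in the limit, the
zero side being absolutely convergent here). [cite: Suzuki2025WeilHilbertSpace, eq. (3.3) (TeX l.804–820); Bombieri2000Weil, Thm. 2 p. 186] -/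
theorem explicit_formula_continuous_bombieri {g : ℝ → ℂ} (hgc : Continuous g)
    (hgs : HasCompactSupport g) {L : ℝ≥0} (hL : LipschitzWith L g)
    (hZ : Summable fun ρ : ZetaZeros.riemannZetaNontrivialZeros ↦
      ‖(riemannZetaZeroOrder (ρ : ℂ) : ℂ) * weilMellin g ρ‖)
    (hA : Integrable fun t : ℝ ↦ weilMellin g (1 / 2 + t * I) * ((Complex.digamma (1 / 4 + t / 2 * I)).re : ℂ)) :
    HasWeilZeroSide g (weilPolarTerm g - weilPrimeTerm g + weilArchTermBombieri g) := by
  rw [weilArchTermBombieri_eq_weilArchTerm_of_lipschitz hgc hgs hL hA]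
  exact explicit_formula_continuous hgc hgs hZ hA

/-- The absolutely convergent zero side equals the right-hand side of (3.3):
`Σ'_ρ m(ρ) ĝ(ρ) = ĝ(0) + ĝ(1) − (prime sums) + (Bombieri's archimedean term)`.
[cite: Suzuki2025WeilHilbertSpace, eq. (3.3) (TeX l.804–820)] -/
theorem tsum_zeroSide_eq_bombieri {g : ℝ → ℂ} (hgc : Continuous g)
    (hgs : HasCompactSupport g) {L : ℝ≥0} (hL : LipschitzWith L g)
    (hZ : Summable fun ρ : ZetaZeros.riemannZetaNontrivialZeros ↦
      ‖(riemannZetaZeroOrder (ρ : ℂ) : ℂ) * weilMellin g ρ‖)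
    (hA : Integrable fun t : ℝ ↦ weilMellin g (1 / 2 + t * I) * ((Complex.digamma (1 / 4 + t / 2 * I)).re : ℂ)) :
    ∑' ρ : ZetaZeros.riemannZetaNontrivialZeros, (riemannZetaZeroOrder (ρ : ℂ) : ℂ) * weilMellin g ρ =
      weilPolarTerm g - weilPrimeTerm g + weilArchTermBombieri g :=
  tendsto_nhds_unique (hasWeilZeroSide_tsum hZ) (explicit_formula_continuous_bombieri hgc hgs hL hZ hA)

end Literature.NumberTheory.LFunctions
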